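import Summits.AnomalousDissipation.AnomalousDissipation.Theorems.SawtoothPulseCascadeK1LocalisedCascadeExactChirp

/-!
# K1loc, line `Spectral` / thin start — helper: THE EXACT ONE-TOOTH CHIRP — EXISTENCE, MAIN LOBES, WEIGHT TABLE (S-D start)

Helper file of the prover lane on the crux `K1LocalisedCascade` (stmt-AnomalousDissipation-19491), route `SawtoothPulseCascade`
(S-B/S-C assembly seat; START of the amplitude ledger).  Companion of `…ExactChirp`:
* §1 `exists_exactChirp`: the circle function `g₀(t) = exp(−2πiλ·tri(2πt)/(2π))` exists (periodic lift) and is continuous —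
  the witness for the hypothesis-form lemmas of `…ExactChirp` / `…ChirpRounding` / `…PhaseOneStart`;
* §2 `norm_fourierCoeff_exactChirp_self_le` / `…_neg_self_le`: the two MAIN LOBES carry `‖ĝ₀(±λ)‖ ≤ ½` (`λ ≠ 0`; one arc
  contributes `½`, the other vanishes by parity);
* §3 `sq_norm_fourierCoeff_exactChirp_eight_le`: for `λ = ±8` the weight table
  `‖ĝ₀(n)‖² ≤ [n even]·[|n| = 8]/4 + [n odd]·(1/(π|8+n|) + 1/(π|8−n|))²` — the fibre weights of the phase-one start at `γ = 8`.
No definitions; nothing about the crux. [cite: Grafakos2014, Prop. 3.1.2 (5)] [problem: turb]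
-/

-- `Summit.<Summit>.<Problem>`: single-conjunct summit, the duplicate namespace segment is deliberate.
set_option linter.dupNamespace false

noncomputable section

namespace Summit.AnomalousDissipation.AnomalousDissipation.Theorems.SawtoothPulseCascade.K1Start

open MeasureTheory Set Filter Topology UnitAddTorus Function Complex AddCircle intervalIntegral
open scoped Real
open Literature.Analysis Literature.Analysis.FunctionSpaces Literature.Analysis.FunctionSpaces.Torus Literature.Analysis.FluidPDE
open Literature.Analysis.FluidPDE.SawtoothCascade

/-! ## §1 Existence of the exact chirp as a continuous circle function -/

/-- **The exact one-tooth chirp exists on the circle**: for `λ ∈ ℤ` there is a continuous `g₀ : 𝕋 → ℂ` with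
`g₀(t) = exp(−2πiλ·tri(2πt)/(2π))` (the `1`-periodic lift). [folklore] -/
theorem exists_exactChirp (lam : ℤ) : ∃ g₀ : UnitAddCircle → ℂ, Continuous g₀ ∧
    ∀ t : ℝ, g₀ (t : UnitAddCircle) = Complex.exp (-(2 * π * I * lam * ((tri (2 * π * t) / (2 * π) : ℝ) : ℂ))) := by
  have hper : Function.Periodic
      (fun t : ℝ => Complex.exp (-(2 * π * I * lam * ((tri (2 * π * t) / (2 * π) : ℝ) : ℂ)))) 1 := by
    intro t
    simp only
    rw [show 2 * π * (t + 1) = 2 * π * t + 2 * π by ring, tri_periodic]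
  refine ⟨hper.lift, ?_, fun t => hper.lift_coe t⟩
  have hf : Continuous fun t : ℝ => Complex.exp (-(2 * π * I * lam * ((tri (2 * π * t) / (2 * π) : ℝ) : ℂ))) := by
    refine Complex.continuous_exp.comp (Continuous.neg (continuous_const.mul (Complex.continuous_ofReal.comp ?_)))
    exact (continuous_tri.comp (continuous_const.mul continuous_id)).div_const _
  have h : hper.lift ∘ (QuotientAddGroup.mk : ℝ → UnitAddCircle) =
      fun t : ℝ => Complex.exp (-(2 * π * I * lam * ((tri (2 * π * t) / (2 * π) : ℝ) : ℂ))) := by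
    funext t; exact hper.lift_coe t
  rw [(QuotientAddGroup.isQuotientMap_mk _).continuous_iff]
  change Continuous (hper.lift ∘ (QuotientAddGroup.mk : ℝ → UnitAddCircle))
  rw [h]
  exact hf

/-! ## §2 The main lobes -/

/-- **The main lobes of the exact chirp**: for `λ ≠ 0`, `‖ĝ₀(−λ)‖ ≤ ½` and `‖ĝ₀(λ)‖ ≤ ½` (on the arc whose character matches,
the integrand is constant of modulus one over a length-`½` arc; the other arc carries the non-zero even frequency `±2λ` and
integrates to zero). [cite: Grafakos2014, Prop. 3.1.2 (5)] -/
theorem norm_fourierCoeff_exactChirp_self_le {lam : ℤ} (hlam : lam ≠ 0) {g₀ : UnitAddCircle → ℂ}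
    (hg₀ : ∀ t : ℝ, g₀ (t : UnitAddCircle) = Complex.exp (-(2 * π * I * lam * ((tri (2 * π * t) / (2 * π) : ℝ) : ℂ))))
    (hg₀c : Continuous g₀) :
    ‖fourierCoeff g₀ (-lam)‖ ≤ 1 / 2 ∧ ‖fourierCoeff g₀ lam‖ ≤ 1 / 2 := by
  have hπ : 0 < π := Real.pi_pos
  -- common set-up: the coefficient as an integral over `[−¼, ¾]`, split at `¼`
  have hF : ∀ q : ℤ, fourierCoeff g₀ q =
      ∫ x in (-(1 / 4) : ℝ)..(-(1 / 4) + 1), (fourier (-q) (x : UnitAddCircle) : ℂ) * g₀ x := fun q => by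
    rw [fourierCoeff_eq_intervalIntegral g₀ q (-(1 / 4))]; simp
  have hrise : ∀ (q : ℤ), ∀ x ∈ uIcc (-(1 / 4) : ℝ) (-(1 / 4) + 1 / 2),
      (fourier (-q) (x : UnitAddCircle) : ℂ) * g₀ x = 1 * Complex.exp (2 * π * I * ((-(lam + q) : ℤ)) * x) := by
    intro q x hx
    rw [uIcc_of_le (by norm_num)] at hx
    have htri : tri (2 * π * x) = 2 * π * x := tri_eq_self (by nlinarith [hx.1]) (by nlinarith [hx.2])
    simp only [hg₀ x, htri, fourier_coe_apply]
    rw [← Complex.exp_add, one_mul]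
    congr 1
    push_cast
    field_simp
    ring
  have hfall : ∀ (q : ℤ), ∀ x ∈ uIcc (1 / 4 : ℝ) (1 / 4 + 1 / 2), (fourier (-q) (x : UnitAddCircle) : ℂ) * g₀ x =
      Complex.exp (-(π * I * lam)) * Complex.exp (2 * π * I * ((lam - q : ℤ)) * x) := by
    intro q x hx
    rw [uIcc_of_le (by norm_num)] at hx
    have htri : tri (2 * π * x) = π - 2 * π * x := tri_eq_pi_sub (by nlinarith [hx.1]) (by nlinarith [hx.2])
    simp only [hg₀ x, htri, fourier_coe_apply]
    rw [← Complex.exp_add, ← Complex.exp_add]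
    congr 1
    push_cast
    field_simp
    ring
  have hsplit : ∀ q : ℤ, (∫ x in (-(1 / 4) : ℝ)..(-(1 / 4) + 1), (fourier (-q) (x : UnitAddCircle) : ℂ) * g₀ x) =
      (∫ x in (-(1 / 4) : ℝ)..(-(1 / 4) + 1 / 2), (fourier (-q) (x : UnitAddCircle) : ℂ) * g₀ x) +
        ∫ x in (1 / 4 : ℝ)..(1 / 4 + 1 / 2), (fourier (-q) (x : UnitAddCircle) : ℂ) * g₀ x := by
    intro q
    have hFc : Continuous fun x : ℝ => (fourier (-q) (x : UnitAddCircle) : ℂ) * g₀ x :=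
      ((fourier (-q)).continuous.comp continuous_quotient_mk').mul (hg₀c.comp continuous_quotient_mk')
    rw [show (-(1 / 4) + 1 : ℝ) = 1 / 4 + 1 / 2 by norm_num]
    have h := (integral_add_adjacent_intervals (a := (-(1 / 4) : ℝ)) (b := -(1 / 4) + 1 / 2) (c := 1 / 4 + 1 / 2)
      (hFc.intervalIntegrable (μ := volume) _ _) (hFc.intervalIntegrable (μ := volume) _ _)).symm
    rw [show (-(1 / 4) + 1 / 2 : ℝ) = 1 / 4 by norm_num] at h ⊢
    exact h
  -- a length-`½` integral of a unimodular constant has norm `½`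
  have hconst : ∀ (z : ℂ), ‖z‖ = 1 → ∀ a : ℝ, ‖∫ x in a..(a + 1 / 2), z * Complex.exp (2 * π * I * ((0 : ℤ)) * x)‖ = 1 / 2 := by
    intro z hz a
    have h1 : (fun x : ℝ => z * Complex.exp (2 * π * I * ((0 : ℤ)) * x)) = fun _ => z := by
      funext x; simp
    rw [h1, intervalIntegral.integral_const, norm_smul, hz, mul_one, Real.norm_eq_abs]
    norm_num
  have hev : Even (2 * lam) := even_two_mul lam
  have h2 : (2 * lam : ℤ) ≠ 0 := by omega
  constructor
  · -- `q = −λ`: rising arc constant (`λ + q = 0`), falling arc frequency `λ − q = 2λ`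
    rw [hF, hsplit, integral_congr (hrise (-lam)), integral_congr (hfall (-lam))]
    have hz : ∫ x in (1 / 4 : ℝ)..(1 / 4 + 1 / 2),
        Complex.exp (-(π * I * lam)) * Complex.exp (2 * π * I * ((lam - -lam : ℤ)) * x) = 0 := by
      rw [show (lam - -lam : ℤ) = 2 * lam by ring]
      exact integral_exp_mul_eq_zero_of_even h2 hev _ _
    rw [hz, add_zero, show (-(lam + -lam) : ℤ) = 0 by ring]
    exact (hconst 1 (by simp) _).le
  · -- `q = λ`: rising arc frequency `−2λ`, falling arc constant
    rw [hF, hsplit, integral_congr (hrise lam), integral_congr (hfall lam)]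
    have hz : ∫ x in (-(1 / 4) : ℝ)..(-(1 / 4) + 1 / 2), (1 : ℂ) * Complex.exp (2 * π * I * ((-(lam + lam) : ℤ)) * x) = 0 := by
      rw [show (-(lam + lam) : ℤ) = 2 * (-lam) by ring]
      exact integral_exp_mul_eq_zero_of_even (by omega) (even_two_mul _) _ _
    rw [hz, zero_add, show (lam - lam : ℤ) = 0 by ring]
    have hu : ‖Complex.exp (-(π * I * lam))‖ = 1 := by
      rw [show (-(π * I * lam) : ℂ) = ((-(π * lam) : ℝ) : ℂ) * I by push_cast; ring, Complex.norm_exp_ofReal_mul_I]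
    exact (hconst _ hu _).le

/-! ## §3 The weight table at `λ = ±8` -/

/-- **Fibre weights of the phase-one start at `γ = 8`**: for the exact chirp with `λ = 8` or `λ = −8`,
`‖ĝ₀(n)‖² ≤ [n even]·[|n| = 8]·¼ + [n odd]·(1/(π|8+n|) + 1/(π|8−n|))²` for every `n ∈ ℤ`
(parity kills even `n ≠ ±8`; the main lobes carry at most `¼`; the rest is the two-sideband bound).
[cite: Grafakos2014, Prop. 3.1.2 (5)] -/
theorem sq_norm_fourierCoeff_exactChirp_eight_le {lam : ℤ} (hlam : lam = 8 ∨ lam = -8) {g₀ : UnitAddCircle → ℂ}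
    (hg₀ : ∀ t : ℝ, g₀ (t : UnitAddCircle) = Complex.exp (-(2 * π * I * lam * ((tri (2 * π * t) / (2 * π) : ℝ) : ℂ))))
    (hg₀c : Continuous g₀) (n : ℤ) :
    ‖fourierCoeff g₀ n‖ ^ 2 ≤
      if Even n then (if |n| = 8 then (1 / 4 : ℝ) else 0)
      else (1 / (π * |((8 + n : ℤ) : ℝ)|) + 1 / (π * |((8 - n : ℤ) : ℝ)|)) ^ 2 := by
  have hlam0 : lam ≠ 0 := by omega
  split_ifs with hev h8
  · -- main lobes
    obtain ⟨hm, hp⟩ := norm_fourierCoeff_exactChirp_self_le hlam0 hg₀ hg₀c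
    have hn : n = lam ∨ n = -lam := by
      rcases hlam with rfl | rfl <;> rcases abs_eq (by norm_num : (0:ℤ) ≤ 8) |>.1 h8 with h | h <;> omega
    rcases hn with h | h
    · rw [h]; nlinarith [norm_nonneg (fourierCoeff g₀ lam)]
    · rw [h]; nlinarith [norm_nonneg (fourierCoeff g₀ (-lam))]
  · -- even `n ≠ ±8`: parity
    have he : Even (lam + n) := by
      rcases hlam with rfl | rfl
      · exact (by decide : Even (8 : ℤ)).add hev
      · exact (by decide : Even (-8 : ℤ)).add hev
    have h1 : n ≠ -lam := by intro h; apply h8; rw [h, abs_neg]; rcases hlam with rfl | rfl <;> norm_num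
    have h2 : n ≠ lam := by intro h; apply h8; rw [h]; rcases hlam with rfl | rfl <;> norm_num
    rw [fourierCoeff_exactChirp_eq_zero_of_even hg₀ hg₀c he h1 h2]; simp
  · -- odd `n`: two sidebands (`n ≠ ±8` since `±8` is even)
    have hodd : Odd n := Int.not_even_iff_odd.1 hev
    have h1 : n ≠ -lam := by rintro rfl; rcases hlam with rfl | rfl <;> exact hev (by decide)
    have h2 : n ≠ lam := by rintro rfl; rcases hlam with rfl | rfl <;> exact hev (by decide)
    have h := norm_fourierCoeff_exactChirp_le hg₀ hg₀c h1 h2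
    have h0 : 0 ≤ ‖fourierCoeff g₀ n‖ := norm_nonneg _
    have hset : 1 / (π * |((lam + n : ℤ) : ℝ)|) + 1 / (π * |((lam - n : ℤ) : ℝ)|) =
        1 / (π * |((8 + n : ℤ) : ℝ)|) + 1 / (π * |((8 - n : ℤ) : ℝ)|) := by
      rcases hlam with rfl | rfl
      · rfl
      · rw [show ((-8 + n : ℤ) : ℝ) = -((8 - n : ℤ) : ℝ) by push_cast; ring,
          show ((-8 - n : ℤ) : ℝ) = -((8 + n : ℤ) : ℝ) by push_cast; ring, abs_neg, abs_neg, add_comm]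
    rw [hset] at h
    exact pow_le_pow_left₀ h0 h 2

/-- **The weight table in terms of `m = |n|`** (the form consumed by `…PhaseOneStartSeries`): for every `n ∈ ℤ`,
`[n even]·[|n| = 8]/4 + [n odd]·(1/(π|8+n|) + 1/(π|8−n|))² ≤ [m odd]·(1/(π(8+m)) + 1/(π|8−m|))² + [m even]·[m = 8]/4` with
`m = n.natAbs` (an equality; the two sidebands swap under `n ↦ −n`). [folklore] -/
theorem weightTable_le_natAbs (n : ℤ) :
    (if Even n then (if |n| = 8 then (1 / 4 : ℝ) else 0)
      else (1 / (π * |((8 + n : ℤ) : ℝ)|) + 1 / (π * |((8 - n : ℤ) : ℝ)|)) ^ 2) ≤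
      (if Odd n.natAbs then (1 / (π * ((8 : ℝ) + n.natAbs)) + 1 / (π * |(8 : ℝ) - n.natAbs|)) ^ 2
        else if n.natAbs = 8 then (1 / 4 : ℝ) else 0) := by
  by_cases hev : Even n
  · have hno : ¬ Odd n.natAbs := fun h => (Int.not_odd_iff_even.2 hev) (Int.natAbs_odd.1 h)
    rw [if_pos hev, if_neg hno]
    by_cases h8 : |n| = 8
    · have h8' : n.natAbs = 8 := by
        have : ((n.natAbs : ℤ)) = 8 := by rw [Int.natCast_natAbs]; exact h8
        exact_mod_cast this
      rw [if_pos h8, if_pos h8']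
    · have h8' : n.natAbs ≠ 8 := by
        intro h; apply h8; rw [Int.abs_eq_natAbs, h]; rfl
      rw [if_neg h8, if_neg h8']
  · have hod : Odd n.natAbs := Int.natAbs_odd.2 (Int.not_even_iff_odd.1 hev)
    rw [if_neg hev, if_pos hod]
    refine le_of_eq ?_
    congr 1
    rcases Int.natAbs_eq n with h | h
    · have hnr : (n : ℝ) = n.natAbs := by
        have h' : ((n : ℤ) : ℝ) = (((n.natAbs : ℕ) : ℤ) : ℝ) := congrArg (fun z : ℤ => (z : ℝ)) h
        rw [h', Int.cast_natCast]
      have e1 : |((8 + n : ℤ) : ℝ)| = (8 : ℝ) + n.natAbs := by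
        push_cast; rw [hnr]; exact abs_of_pos (by positivity)
      have e2 : |((8 - n : ℤ) : ℝ)| = |(8 : ℝ) - n.natAbs| := by push_cast; rw [hnr]
      rw [e1, e2]
    · have hnr : (n : ℝ) = -(n.natAbs : ℝ) := by
        have h' : ((n : ℤ) : ℝ) = ((-(n.natAbs : ℕ) : ℤ) : ℝ) := congrArg (fun z : ℤ => (z : ℝ)) h
        rw [h', Int.cast_neg, Int.cast_natCast]
      have e1 : |((8 + n : ℤ) : ℝ)| = |(8 : ℝ) - n.natAbs| := by push_cast; rw [hnr, ← sub_eq_add_neg]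
      have e2 : |((8 - n : ℤ) : ℝ)| = (8 : ℝ) + n.natAbs := by
        push_cast; rw [hnr, sub_neg_eq_add]; exact abs_of_pos (by positivity)
      rw [e1, e2, add_comm]

end Summit.AnomalousDissipation.AnomalousDissipation.Theorems.SawtoothPulseCascade.K1Start
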